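/-
Copyright: the b2b-balaban T⁴-continuum CRUX team, row NE7b leaf lineage `t4-ne7b-formalise-leaf-06` (gen 153). Project licence.
-/
import Mathlib.Analysis.Calculus.SmoothSeries
import Mathlib.Analysis.Calculus.Taylor
import Mathlib.Analysis.Calculus.IteratedDeriv.Lemmas
import Mathlib.Analysis.SpecialFunctions.Trigonometric.Deriv
import Mathlib.Analysis.SpecialFunctions.Exp
import Mathlib.Topology.Algebra.InfiniteSum.NatInt

/-!
# THE MOMENTUM-SMOOTHNESS LETTER IS LOCALITY — INFINITE SUPPORT: for a kernel `k` on a COUNTABLE index with real frequencies `ω`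
# and SUMMABLE absolute moments `Σ' |k i|·|ω i|ⁿ` (`n ≤ N`), the symbol `Φ(t) = Σ'_i k i·cos(ω i·t)` is `Cᴺ` with
# `|Φ⁽ⁿ⁾(t)| ≤ Σ'_i |k i|·|ω i|ⁿ`, even, `Φ(0) = Σ' k i`, `Φ″(0) = −Σ' k i·(ω i)²`, and (`N = 4`) the subtracted letter
# `|Φ(t) − ½Φ″(0)t²| ≤ (Σ' |k i|·(ω i)⁴)∕24 · t⁴`; an exponential decay `|k x| ≤ Me^{−κ|x|}` on `ℤ` makes EVERY moment summable
# (row NE7b, node U5c; the infinite-support companion of `…LatticeKernelMoments`, [folklore] dominated differentiation of series)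

Cell `pub-balaban`, sub-cell `t4`, spine estimate NE7b (`T4WeightBudget.RelWeightBound`; the cell's OWN estimate — NOT PRINTED in
[Bałaban 1983–89], NOT PROVED).  Crux-route work under `Spine/NE7b/` by a row leaf on the convexity road under FREEZE (0)'s crux-prover
clause; NOTHING of Bałaban's is named or asserted; no `T4Continuum/Support` leaf typed; no `def`; zero `sorry`.  Imports: Mathlib only
(`…LatticeKernelMoments` (LKM, leaf-01, retry lane), `…InheritedHessianPowerCounting` (IHPC) and `…InheritedHessianPowerCountingLocal`
(IHPCL, this lineage) have no hub olean; nothing of theirs is imported or restated — the finite-sum symbol is LKM's, the `Σ'` symbol here).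

WHY.  LKM types, for a FINITELY supported kernel, that IHPC's letters (W) ∕ (R) ∕ (D) come from the position-space kernel: `Φ(0) = Σ k`,
evenness, `|Φ⁽ⁿ⁾| ≤ Σ |k i|·|ω i|ⁿ`; its NOT-HERE lists «infinite support (a `tsum` symbol; dominated differentiation)».  Print's inherited
kernels are NOT finitely supported: they have infinite range with a tree decay `E₀e^{−κ d_j(X)}` ([B12] (1.18), read BY SHAPE), so the honest
model is `Φ(t) = Σ'_i k i·cos(ω i·t)` over a countable index with summable moments.  THIS FILE types it with Mathlib's `contDiff_tsum` ∕
`iteratedFDeriv_tsum_apply` (uniform summable bounds on the termwise derivatives = the absolute moments): `Φ ∈ Cᴺ`, the `n`-th derivative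
letter IS the `n`-th absolute moment, `Φ″(0)` is minus the second moment, the subtracted letter with the Lagrange constant `1∕24` (Taylor on
`[0,1]` along `s ↦ Φ(s t)`), and on `ℤ` the exponential decay supplies every moment (`Σ_{m∈ℤ} |m|ⁿe^{−κ|m|} < ∞`).

WHAT IS PROVED ([folklore]; Mathlib's `contDiff_tsum`, `iteratedFDeriv_tsum_apply`, `norm_iteratedFDeriv_eq_norm_iteratedDeriv`,
`iteratedDeriv_comp_const_mul`, `abs_iteratedDeriv_cos_le_one`, `taylor_mean_remainder_lagrange_iteratedDeriv`, `summable_pow_mul_exp_neg_nat_mul`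
BY NAME; throughout `k ω : ι → ℝ`, the term `t ↦ k i·cos(ω i·t)` and the symbol `t ↦ Σ' i, k i·cos(ω i·t)` written inline):
* §1 TERMWISE: `iteratedDeriv_term` (`(k·cos(ω·))⁽ⁿ⁾(t) = k·ωⁿ·cos⁽ⁿ⁾(ωt)`), `contDiff_term`, **`norm_iteratedFDeriv_term_le`**
  (`‖Dⁿ(k i·cos(ω i·))(t)‖ ≤ |k i|·|ω i|ⁿ` — the uniform bound `contDiff_tsum` wants), `summable_term` (moment `n = 0` ⟹ the series converges).
* §2 THE SYMBOL (hypothesis `hmom : ∀ n ≤ N, Summable (|k ·|·|ω ·|ⁿ)`): **`contDiff_symbol`** (`Φ ∈ Cᴺ`), **`abs_iteratedDeriv_symbol_le`**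
  (`|Φ⁽ⁿ⁾(t)| ≤ Σ' |k i|·|ω i|ⁿ`, `n ≤ N` — the (D) letter IS the absolute moment), `symbol_neg` (even — (R)), `symbol_zero` (`Φ(0) = Σ' k i` —
  (W) is «the kernel annihilates constants»), **`iteratedDeriv_symbol_eq_tsum`** (`Φ⁽ⁿ⁾(t) = Σ' (k i·cos(ω i·))⁽ⁿ⁾(t)`, evaluation commutes with
  the sum by `ContinuousLinearMap.map_tsum` on the CMM-summable family), **`iteratedDeriv_two_symbol_zero`** (`Φ″(0) = −Σ' k i·(ω i)²`).
* §3 THE SUBTRACTED LETTER (`N = 4`): **`abs_symbol_sub_marginal_le`** — `Σ' k i = 0` ⟹ for every `t`,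
  `|Φ(t) + ½(Σ' k i·(ω i)²)·t²| ≤ (Σ' |k i|·(ω i)⁴)∕24 · t⁴` (Taylor–Lagrange on `[0,1]` for `s ↦ Φ(st)`; IHPC §6's `hR` shape with `C = M₄∕24`).
* §4 DECAY GIVES THE MOMENTS on `ℤ`: **`summable_moment_of_decay`** (`|k x| ≤ M·e^{−κ|x|}`, `κ > 0` ⟹ `Summable (|k x|·|x|ⁿ)` for EVERY `n` —
  both half-lines by `summable_pow_mul_exp_neg_nat_mul`, glued by `Summable.of_nat_of_neg`), **`abs_symbol_sub_marginal_le_of_decay`**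
  (§3 for `ω x = x` under the decay, moments finite by §4).
* §5 toy (kernel): one term `k = 1`, `ω = 1` on `Unit`: `|cos t − 1 + t²∕2| ≤ t⁴∕24`-shape instance of §3's hypotheses (`Σ' k = 1 ≠ 0`, so the
  toy checks §2's `Φ(0)` and evenness instead).

NOT HERE (honest): form-valued kernels; `d`-dimensional rays are the case `ι = (Fin d → ℤ)`, `ω x = Σ_j x_j e_j` of §2–§3 (no separate
statement; the directional moments `Σ' |k x|·|⟨x,e⟩|ⁿ` are the consumer's, bounded by isotropic ones with `|⟨x,e⟩| ≤ ‖x‖₁‖e‖_∞`); the junctions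
with LKM ∕ IHPC ∕ IHPCL BY IMPORT (olean); WHICH kernels print's inherited terms have and their `(M, κ)` ([B12] (1.18) BY SHAPE only; (A3) ∕
(A1c), NC-NE7b-α UNRULED); anything of Bałaban's.  BY-NAME EFFECT ON THE WALL: NONE (a supplier for IHPC's displayed letters).  NE7b NOT
PRINTED ∕ NOT PROVED; spine PROVED 0∕9; rung (B)+1 on a FINITE torus — NOT infinite volume, NOT the mass gap, NOT Clay.  HONEST DEPENDENCY:
continuum YM on T⁴ ⇐ BetaPertH ∧ nine spine estimates (0∕9 proved); BetaPertH ⇐ (D1) ∧ (D4) ∧ CAP+tail; G-an2-4 gates asym, D1 and NE2∕3∕4.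
-/

set_option autoImplicit false

noncomputable section

open Set Filter Topology Real

namespace Summit.QuantumFields.BalabanUV.T4Continuum.NE7b.LatticeKernelMomentsSummable

variable {ι : Type*}

/-! ## §1 Termwise letters -/

/-- `(k·cos(ω·))⁽ⁿ⁾(t) = k·ωⁿ·cos⁽ⁿ⁾(ωt)`. [folklore] -/
theorem iteratedDeriv_term (k ω : ℝ) (n : ℕ) (t : ℝ) :
    iteratedDeriv n (fun s : ℝ => k * cos (ω * s)) t = k * (ω ^ n * iteratedDeriv n cos (ω * t)) := by
  rw [iteratedDeriv_const_mul_field]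
  congr 1
  have h := iteratedDeriv_comp_const_mul (n := n) (contDiff_cos.of_le le_top) ω
  exact congrFun h t

/-- Each term is smooth. [folklore] -/
theorem contDiff_term (k ω : ℝ) {n : WithTop ℕ∞} : ContDiff ℝ n fun s : ℝ => k * cos (ω * s) :=
  contDiff_const.mul (contDiff_cos.comp (contDiff_const.mul contDiff_id))

/-- **THE UNIFORM TERMWISE BOUND**: `‖Dⁿ(k·cos(ω·))(t)‖ ≤ |k|·|ω|ⁿ` for every `t` (`|cos⁽ⁿ⁾| ≤ 1`). [folklore] -/
theorem norm_iteratedFDeriv_term_le (k ω : ℝ) (n : ℕ) (t : ℝ) :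
    ‖iteratedFDeriv ℝ n (fun s : ℝ => k * cos (ω * s)) t‖ ≤ |k| * |ω| ^ n := by
  rw [norm_iteratedFDeriv_eq_norm_iteratedDeriv, iteratedDeriv_term, Real.norm_eq_abs, abs_mul, abs_mul, abs_pow]
  have h1 : |iteratedDeriv n cos (ω * t)| ≤ 1 := abs_iteratedDeriv_cos_le_one n (ω * t)
  have h2 : 0 ≤ |k| * |ω| ^ n := by positivity
  calc |k| * (|ω| ^ n * |iteratedDeriv n cos (ω * t)|) = |k| * |ω| ^ n * |iteratedDeriv n cos (ω * t)| := by ring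
    _ ≤ |k| * |ω| ^ n * 1 := by gcongr
    _ = |k| * |ω| ^ n := mul_one _

/-- The zeroth moment makes the series converge absolutely at every `t`. [folklore] -/
theorem summable_term {k ω : ι → ℝ} (h0 : Summable fun i => |k i|) (t : ℝ) : Summable fun i => k i * cos (ω i * t) := by
  refine Summable.of_norm_bounded h0 fun i => ?_
  rw [Real.norm_eq_abs, abs_mul]
  exact mul_le_of_le_one_right (abs_nonneg _) (abs_cos_le_one _)

/-! ## §2 The symbol of a kernel with summable moments -/

section Symbol

variable {k ω : ι → ℝ} {N : ℕ}

/-- The moment hypotheses in the shape `contDiff_tsum` consumes. -/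
theorem summable_bound_of_moments (hmom : ∀ n : ℕ, n ≤ N → Summable fun i => |k i| * |ω i| ^ n) :
    ∀ n : ℕ, (n : ℕ∞) ≤ (N : ℕ∞) → Summable fun i => |k i| * |ω i| ^ n :=
  fun n hn => hmom n (by exact_mod_cast hn)

/-- **THE SYMBOL IS `Cᴺ`** when the absolute moments of order `≤ N` are summable (Mathlib's `contDiff_tsum`). [folklore] -/
theorem contDiff_symbol (hmom : ∀ n : ℕ, n ≤ N → Summable fun i => |k i| * |ω i| ^ n) :
    ContDiff ℝ N fun t : ℝ => ∑' i, k i * cos (ω i * t) :=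
  contDiff_tsum (N := (N : ℕ∞)) (fun i => contDiff_term (k i) (ω i)) (summable_bound_of_moments hmom)
    fun n i t _ => norm_iteratedFDeriv_term_le (k i) (ω i) n t

/-- **THE `n`-TH DERIVATIVE LETTER IS THE `n`-TH ABSOLUTE MOMENT**: `|Φ⁽ⁿ⁾(t)| ≤ Σ' |k i|·|ω i|ⁿ` for `n ≤ N`. [folklore] -/
theorem abs_iteratedDeriv_symbol_le (hmom : ∀ n : ℕ, n ≤ N → Summable fun i => |k i| * |ω i| ^ n) {n : ℕ} (hn : n ≤ N)
    (t : ℝ) : |iteratedDeriv n (fun t : ℝ => ∑' i, k i * cos (ω i * t)) t| ≤ ∑' i, |k i| * |ω i| ^ n := by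
  rw [← Real.norm_eq_abs, ← norm_iteratedFDeriv_eq_norm_iteratedDeriv,
    iteratedFDeriv_tsum_apply (N := (N : ℕ∞)) (fun i => contDiff_term (k i) (ω i)) (summable_bound_of_moments hmom)
      (fun n i t _ => norm_iteratedFDeriv_term_le (k i) (ω i) n t) (by exact_mod_cast hn) t]
  exact tsum_of_norm_bounded (hmom n hn).hasSum fun i => norm_iteratedFDeriv_term_le (k i) (ω i) n t

/-- **EVEN** (letter (R)): `Φ(−t) = Φ(t)`. [folklore] -/
theorem symbol_neg (k ω : ι → ℝ) (t : ℝ) : (∑' i, k i * cos (ω i * -t)) = ∑' i, k i * cos (ω i * t) := by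
  simp [mul_neg, cos_neg]

/-- **AT ZERO MOMENTUM THE SYMBOL IS THE TOTAL MASS** (letter (W) is «`Σ' k i = 0`»): `Φ(0) = Σ' k i`. [folklore] -/
theorem symbol_zero (k ω : ι → ℝ) : (∑' i, k i * cos (ω i * (0 : ℝ))) = ∑' i, k i := by
  simp

/-- **THE DERIVATIVES OF THE SYMBOL ARE THE SERIES OF THE TERMWISE DERIVATIVES**: `Φ⁽ⁿ⁾(t) = Σ' i, (k i·cos(ω i·))⁽ⁿ⁾(t)` for `n ≤ N`
(Mathlib's `iteratedFDeriv_tsum_apply`, then evaluation at `(1,…,1)` commutes with the CMM-summable series by `ContinuousLinearMap.map_tsum`).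
[folklore] -/
theorem iteratedDeriv_symbol_eq_tsum (hmom : ∀ n : ℕ, n ≤ N → Summable fun i => |k i| * |ω i| ^ n) {n : ℕ} (hn : n ≤ N)
    (t : ℝ) : iteratedDeriv n (fun t : ℝ => ∑' i, k i * cos (ω i * t)) t = ∑' i, iteratedDeriv n (fun s : ℝ => k i * cos (ω i * s)) t := by
  have hsum : Summable fun i => iteratedFDeriv ℝ n (fun s : ℝ => k i * cos (ω i * s)) t :=
    Summable.of_norm_bounded (hmom n hn) fun i => norm_iteratedFDeriv_term_le (k i) (ω i) n t
  rw [iteratedDeriv_eq_iteratedFDeriv,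
    iteratedFDeriv_tsum_apply (N := (N : ℕ∞)) (fun i => contDiff_term (k i) (ω i)) (summable_bound_of_moments hmom)
      (fun n i t _ => norm_iteratedFDeriv_term_le (k i) (ω i) n t) (by exact_mod_cast hn) t]
  have h := (ContinuousMultilinearMap.apply ℝ (fun _ : Fin n => ℝ) ℝ (fun _ => (1 : ℝ))).map_tsum hsum
  simp only [ContinuousMultilinearMap.apply_apply] at h
  rw [h]
  rfl

/-- **THE MARGINAL COEFFICIENT IS MINUS THE SECOND MOMENT**: `Φ″(0) = −Σ' k i·(ω i)²` (`2 ≤ N`). [folklore] -/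
theorem iteratedDeriv_two_symbol_zero (hmom : ∀ n : ℕ, n ≤ N → Summable fun i => |k i| * |ω i| ^ n) (hN : 2 ≤ N) :
    iteratedDeriv 2 (fun t : ℝ => ∑' i, k i * cos (ω i * t)) 0 = -∑' i, k i * ω i ^ 2 := by
  rw [iteratedDeriv_symbol_eq_tsum hmom hN, ← tsum_neg]
  refine tsum_congr fun i => ?_
  rw [iteratedDeriv_term, mul_zero, iteratedDeriv_even_cos 1]
  simp

end Symbol

/-! ## §3 The subtracted letter (`N = 4`): `|Φ(t) − ½Φ″(0)t²| ≤ (M₄∕24)·t⁴` -/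

section Subtracted

variable {k ω : ι → ℝ}

/-- **THE SUBTRACTED SYMBOL IS `O(t⁴)` WITH THE FOURTH ABSOLUTE MOMENT** [folklore]: moments of order `≤ 4` summable and the Ward letter
`Σ' k i = 0` ⟹ for every `t`, `|Φ(t) + ½(Σ' k i·(ω i)²)·t²| ≤ (Σ' |k i|·(ω i)⁴)∕24 · t⁴`.  Proof: Taylor–Lagrange on `[0,1]` for the even
`C⁴` function `s ↦ Φ(st)` (`(Φ(·t))⁗(s) = t⁴Φ⁗(st)`, odd derivatives vanish at `0`, `Φ(0) = 0`). -/
theorem abs_symbol_sub_marginal_le (hmom : ∀ n : ℕ, n ≤ 4 → Summable fun i => |k i| * |ω i| ^ n) (hW : ∑' i, k i = 0)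
    (t : ℝ) :
    |(∑' i, k i * cos (ω i * t)) + 1 / 2 * (∑' i, k i * ω i ^ 2) * t ^ 2| ≤ (∑' i, |k i| * |ω i| ^ 4) / 24 * t ^ 4 := by
  set Φ : ℝ → ℝ := fun t => ∑' i, k i * cos (ω i * t) with hΦ
  have hΦC : ContDiff ℝ 4 Φ := contDiff_symbol (N := 4) hmom
  -- the ray `g s = Φ (s t)` = `Φ (t s)`
  set g : ℝ → ℝ := fun s => Φ (t * s) with hg
  have hgC : ContDiff ℝ 4 g := hΦC.comp (contDiff_const.mul contDiff_id)
  have hgder : ∀ n : ℕ, n ≤ 4 → ∀ s, iteratedDeriv n g s = t ^ n * iteratedDeriv n Φ (t * s) := by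
    intro n hn s
    have h := iteratedDeriv_comp_const_mul (n := n) (hΦC.of_le (by exact_mod_cast hn)) t
    exact congrFun h s
  have heven : ∀ s, g (-s) = g s := fun s => by
    simp only [hg, hΦ]
    rw [mul_neg]
    exact symbol_neg k ω (t * s)
  have hodd : ∀ {n : ℕ}, Odd n → iteratedDeriv n g 0 = 0 := by
    intro n hn
    have h := iteratedDeriv_comp_neg n g 0
    rw [show (fun x => g (-x)) = g from funext heven, neg_zero, hn.neg_one_pow, neg_one_smul] at h
    linarith
  have hg0 : g 0 = 0 := by simp [hg, hΦ, hW]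
  have hU : UniqueDiffOn ℝ (Icc (0 : ℝ) 1) := uniqueDiffOn_Icc zero_lt_one
  have hf : ContDiffOn ℝ (3 + 1) g (uIcc 0 1) := by norm_num; exact hgC.contDiffOn
  obtain ⟨ξ, hξ, hL⟩ := taylor_mean_remainder_lagrange_iteratedDeriv (f := g) (n := 3) (x₀ := 0) (x := 1) zero_ne_one hf
  rw [uIcc_of_le zero_le_one] at hL
  have hw : ∀ {n : ℕ}, n ≤ 4 → iteratedDerivWithin n g (Icc 0 1) 0 = iteratedDeriv n g 0 := fun hn =>
    iteratedDerivWithin_eq_iteratedDeriv hU (hgC.contDiffAt.of_le (by exact_mod_cast hn)) (left_mem_Icc.2 zero_le_one)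
  have hev : taylorWithinEval g 3 (Icc 0 1) 0 1 = iteratedDeriv 2 g 0 / 2 := by
    simp [taylorWithinEval_succ, taylor_within_zero_eval, hw (show 1 ≤ 4 by norm_num), hw (show 2 ≤ 4 by norm_num),
      hw (show 3 ≤ 4 by norm_num), hodd odd_one, hodd (show Odd 3 by decide), hg0]
    ring
  have key : iteratedDeriv (3 + 1) g ξ * (1 - 0) ^ (3 + 1) / ((3 + 1).factorial : ℝ) = iteratedDeriv 4 g ξ / 24 := by
    norm_num [Nat.factorial]
  rw [hev, key] at hL
  -- identify the pieces
  have hg1 : g 1 = Φ t := by simp [hg]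
  have hg2 : iteratedDeriv 2 g 0 = -(∑' i, k i * ω i ^ 2) * t ^ 2 := by
    rw [hgder 2 (by norm_num) 0, mul_zero, iteratedDeriv_two_symbol_zero (N := 4) hmom (by norm_num)]
    ring
  have hg4 : |iteratedDeriv 4 g ξ| ≤ t ^ 4 * ∑' i, |k i| * |ω i| ^ 4 := by
    have ht4 : |t| ^ 4 = t ^ 4 := by rw [← abs_pow]; exact abs_of_nonneg (by positivity)
    rw [hgder 4 le_rfl ξ, abs_mul, abs_pow, ht4]
    exact mul_le_mul_of_nonneg_left (abs_iteratedDeriv_symbol_le (N := 4) hmom le_rfl _) (by positivity)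
  have hmain : |g 1 - iteratedDeriv 2 g 0 / 2| ≤ (t ^ 4 * ∑' i, |k i| * |ω i| ^ 4) / 24 := by
    rw [hL, abs_div, abs_of_pos (show (0 : ℝ) < 24 by norm_num)]
    exact div_le_div_of_nonneg_right hg4 (by norm_num)
  rw [hg1, hg2] at hmain
  have e1 : Φ t - -(∑' i, k i * ω i ^ 2) * t ^ 2 / 2 = (∑' i, k i * cos (ω i * t)) + 1 / 2 * (∑' i, k i * ω i ^ 2) * t ^ 2 := by
    simp only [hΦ]; ring
  have e2 : (t ^ 4 * ∑' i, |k i| * |ω i| ^ 4) / 24 = (∑' i, |k i| * |ω i| ^ 4) / 24 * t ^ 4 := by ring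
  rw [e1, e2] at hmain
  exact hmain

end Subtracted

/-! ## §4 On `ℤ`: exponential decay gives every moment -/

section Decay

/-- **DECAY GIVES THE MOMENTS**: `|k x| ≤ M·e^{−κ|x|}` on `ℤ` with `κ > 0` ⟹ `Σ_{x∈ℤ} |k x|·|x|ⁿ < ∞` for EVERY `n` (both half-lines by
Mathlib's `summable_pow_mul_exp_neg_nat_mul`, glued by `Summable.of_nat_of_neg`). [folklore] -/
theorem summable_moment_of_decay {k : ℤ → ℝ} {M κ : ℝ} (hκ : 0 < κ) (hdecay : ∀ x : ℤ, |k x| ≤ M * exp (-κ * |(x : ℝ)|))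
    (n : ℕ) : Summable fun x : ℤ => |k x| * |(x : ℝ)| ^ n := by
  have hM : 0 ≤ M := by
    have h := hdecay 0
    simp only [Int.cast_zero, abs_zero, mul_zero, exp_zero, mul_one] at h
    exact (abs_nonneg _).trans h
  -- the majorant `x ↦ M·|x|ⁿ·e^{−κ|x|}` is summable over `ℤ`
  have hmaj : Summable fun x : ℤ => M * (|(x : ℝ)| ^ n * exp (-κ * |(x : ℝ)|)) := by
    refine (Summable.of_nat_of_neg ?_ ?_).mul_left M
    · simpa [Nat.abs_cast] using summable_pow_mul_exp_neg_nat_mul n hκ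
    · simpa [abs_neg, Nat.abs_cast] using summable_pow_mul_exp_neg_nat_mul n hκ
  refine Summable.of_nonneg_of_le (fun x => by positivity) (fun x => ?_) hmaj
  calc |k x| * |(x : ℝ)| ^ n ≤ M * exp (-κ * |(x : ℝ)|) * |(x : ℝ)| ^ n :=
        mul_le_mul_of_nonneg_right (hdecay x) (by positivity)
    _ = M * (|(x : ℝ)| ^ n * exp (-κ * |(x : ℝ)|)) := by ring

/-- **THE SUBTRACTED LETTER UNDER EXPONENTIAL DECAY** (`ι = ℤ`, `ω x = x`): `|k x| ≤ M·e^{−κ|x|}`, `κ > 0`, `Σ' k = 0` ⟹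
`|Φ(t) + ½(Σ' k x·x²)t²| ≤ (Σ' |k x|·x⁴)∕24 · t⁴` for every `t`. [folklore] -/
theorem abs_symbol_sub_marginal_le_of_decay {k : ℤ → ℝ} {M κ : ℝ} (hκ : 0 < κ)
    (hdecay : ∀ x : ℤ, |k x| ≤ M * exp (-κ * |(x : ℝ)|)) (hW : ∑' x, k x = 0) (t : ℝ) :
    |(∑' x : ℤ, k x * cos ((x : ℝ) * t)) + 1 / 2 * (∑' x : ℤ, k x * (x : ℝ) ^ 2) * t ^ 2|
      ≤ (∑' x : ℤ, |k x| * |(x : ℝ)| ^ 4) / 24 * t ^ 4 :=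
  abs_symbol_sub_marginal_le (ω := fun x : ℤ => (x : ℝ)) (fun n _ => summable_moment_of_decay hκ hdecay n) hW t

end Decay

/-! ## §5 Toy (kernel): one term -/

/-- One term (`ι = Unit`, `k = 1`, `ω = 1`): the symbol is `cos`, `Φ(0) = Σ' k = 1` and `Φ(−t) = Φ(t)`. -/
example (t : ℝ) : (∑' _ : Unit, (1 : ℝ) * cos (1 * -t)) = ∑' _ : Unit, (1 : ℝ) * cos (1 * t) :=
  symbol_neg (fun _ : Unit => (1 : ℝ)) (fun _ => 1) t

example : (∑' _ : Unit, (1 : ℝ) * cos (1 * (0 : ℝ))) = 1 := by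
  rw [symbol_zero (fun _ : Unit => (1 : ℝ)) (fun _ => 1)]
  simp

end Summit.QuantumFields.BalabanUV.T4Continuum.NE7b.LatticeKernelMomentsSummable

end
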